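import Mathlib
import HarnessLib
import Summits.NavierStokesRegularity.NavierStokesRegularity.Theorems.SubOnsagerCeilingKPChainLightCone
import Summits.NavierStokesRegularity.NavierStokesRegularity.Theorems.SubOnsagerCeilingKPChainPeak

/-!
# Before one turnover time of the datum shell EVERY weighted barrier of the Katz–Pavlović chain holds, ν-uniformly
# (helper file for the crux `SubOnsagerCeiling.ForwardTailCeilingKP`, stmt-NavierStokesRegularity-27057, `--supports`;
# corollary of `Theorems/SubOnsagerCeilingKPChainLightCone.lean` + `…KPChainPeak.lean`)

Chain format VERBATIM that of `…KPChainPeak.lean` / `…KPChainLightCone.lean`: an honest solution `Z_k : [0,s] → ℝ` (`k ≥ -1`,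
`Z_{-1} ≡ 0`) of `Ż_k = c₀ (b^{5(k-1)/2} Z_{k-1}² − b^{5k/2} Z_k Z_{k+1}) − ν b^{2k} Z_k` (`c₀, ν ≥ 0`, `b > 0`) from the one-shell
datum `Z_k(0) = x₀ 1_{k=0}`, continuous, non-negative on the shells `k ≥ 1`.

The registered stubs `stub_primaryGradedLargeRatio` / `stub_primaryGradedSmallRatio` ask (restricted to the chain) for a
ν-uniform weighted barrier `b^{2θk} Z_k(t)² ≤ D x₀²` with `1/2 < θ ≤ 1` for ALL `t`.  This file records WHEN such a barrier can
first fail: never before the Λ-scaled turnover time of the datum shell.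

* `kpChain_superBarrier_before_turnover` — for every `t ∈ [0,s]` with `c₀ b^{5/2} |x₀| t ≤ 1` and every shell `j ≥ 0`:
  `b^{5j} · Z_j(t)² ≤ x₀²` — the weighted barrier with the SUPER-Kolmogorov exponent `θ = 5/2` and constant `D = 1`
  (the datum shell never exceeds `|x₀|` — `KPChainPeak.datum_sq_le` — and the light cone `KPChainLightCone.lightCone_sq` from
  that cap with `k = 0`, `M = |x₀|`, `(Kt)^{2^j−1} ≤ 1`);
* `kpChain_barrier_before_turnover` — hence every `(θ, D)` barrier with `θ ≤ 5/2`, `D ≥ 1` (in particular every barrier the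
  stubs ask for) holds on the initial window `t ≤ 1/(c₀ b^{5/2} |x₀|)`, uniformly in `ν`, `b ≥ 1`, `s`.

Reading: a first failure of the registered barrier (the «first overshoot» of `…KPChainFirstOvershoot.lean`) happens at a time
`t⋆ > 1/(c₀ Λ |x₀|)` — after the datum shell has turned over once; combined with the shell-shift covariance of the chain this is
the statement that the front needs one (Λ-scaled) turnover time per shell.  Causality only; not a barrier for all times.
HONEST FRAMING: statements about a MODEL lattice ODE (route SubOnsagerCeiling, rung TL-M2Break); no stub, crux or summit is proved
here and nothing in this file bears on Navier–Stokes regularity.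
[cite: Tao2016AveragedNS, §4 (4.13)] [cite: BarbatoMorandinRomito2011, §2 (the chain)]
-/

noncomputable section

-- the sub-problem namespace `NavierStokesRegularity.NavierStokesRegularity` is the tree's layout (D-0017)
set_option linter.dupNamespace false

namespace Summit.NavierStokesRegularity.NavierStokesRegularity.Theorems.KPChainLightCone

open Set MeasureTheory intervalIntegral

/-- **Super-Kolmogorov barrier before one turnover time.** Along an honest non-negative solution of the viscous chain from the
one-shell datum (`c₀, ν ≥ 0`, `b > 0`), for every `t ∈ [0,s]` with `c₀ b^{5/2} |x₀| t ≤ 1` and every shell `j`: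
`b^{5j} Z_j(t)² ≤ x₀²` (weighted barrier `θ = 5/2`, `D = 1`), uniformly in `ν`. [this file] -/
theorem kpChain_superBarrier_before_turnover {b c₀ ν s x₀ : ℝ} (hb : 0 < b) (hc₀ : 0 ≤ c₀) (hν : 0 ≤ ν)
    {Z : ℤ → ℝ → ℝ}
    (hdat : ∀ k : ℤ, Z k 0 = if k = 0 then x₀ else 0)
    (hvan : ∀ t, Z (-1) t = 0)
    (hcont : ∀ k : ℕ, ContinuousOn (Z k) (Icc 0 s))
    (hode : ∀ k : ℕ, ∀ t ∈ Icc 0 s, HasDerivWithinAt (Z k)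
      (c₀ * (b ^ ((5 : ℝ) * ((k : ℝ) - 1) / 2) * Z ((k : ℤ) - 1) t ^ 2 -
          b ^ ((5 : ℝ) * (k : ℝ) / 2) * (Z k t * Z ((k : ℤ) + 1) t)) -
        ν * b ^ ((2 : ℝ) * (k : ℝ)) * Z k t) (Icc 0 s) t)
    (hnn : ∀ t ∈ Icc 0 s, ∀ k : ℕ, 1 ≤ k → 0 ≤ Z k t)
    {t : ℝ} (ht : t ∈ Icc 0 s) (hturn : c₀ * b ^ ((5 : ℝ) / 2) * |x₀| * t ≤ 1) (j : ℕ) :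
    b ^ ((5 : ℝ) * (j : ℝ)) * Z (j : ℤ) t ^ 2 ≤ x₀ ^ 2 := by
  -- the datum shell is capped by `|x₀|` on `[0,t]`
  have hcap : ∀ τ ∈ Icc 0 t, Z ((0 : ℕ) : ℤ) τ ^ 2 ≤ |x₀| ^ 2 := by
    intro τ hτ
    rw [sq_abs]
    exact KPChainPeak.datum_sq_le hc₀ hν hdat hvan hcont hode hnn τ ⟨hτ.1, hτ.2.trans ht.2⟩
  -- the light cone from that cap with `k = 0`, `M = |x₀|`, at the shell `0 + j` and the time `t`
  have hcone := lightCone_sq hb hc₀ hν hdat hcont hode hnn 0 (abs_nonneg x₀) ht hcap j t ⟨ht.1, le_rfl⟩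
  have hidx : (((0 + j : ℕ)) : ℤ) = (j : ℤ) := by push_cast; ring
  have hexp1 : b ^ ((5 : ℝ) * (((0 : ℕ) : ℝ) + 1) / 2) = b ^ ((5 : ℝ) / 2) := by norm_num
  rw [hidx, hexp1] at hcone
  -- `(K t)^{2^j - 1} ≤ 1`
  set K : ℝ := c₀ * b ^ ((5 : ℝ) / 2) * |x₀| with hK
  have hKt0 : 0 ≤ K * t := mul_nonneg (mul_nonneg (mul_nonneg hc₀ (Real.rpow_pos_of_pos hb _).le) (abs_nonneg _)) ht.1
  have hKt1 : K * t ≤ 1 := hturn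
  have hP : (K * t) ^ (2 ^ j - 1) ≤ 1 := pow_le_one₀ hKt0 hKt1
  have hP0 : 0 ≤ (K * t) ^ (2 ^ j - 1) := pow_nonneg hKt0 _
  set Bj : ℝ := b ^ (-((5 : ℝ) * (j : ℝ) / 2)) with hBj
  have hBj0 : 0 ≤ Bj := (Real.rpow_pos_of_pos hb _).le
  have hMB : 0 ≤ (|x₀| * Bj) ^ 2 := sq_nonneg _
  have h1 : Z (j : ℤ) t ^ 2 ≤ (|x₀| * Bj) ^ 2 := by
    calc Z (j : ℤ) t ^ 2 ≤ (|x₀| * Bj * (K * t) ^ (2 ^ j - 1)) ^ 2 := hcone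
      _ = (|x₀| * Bj) ^ 2 * ((K * t) ^ (2 ^ j - 1)) ^ 2 := by ring
      _ ≤ (|x₀| * Bj) ^ 2 * 1 := mul_le_mul_of_nonneg_left (pow_le_one₀ hP0 hP) hMB
      _ = (|x₀| * Bj) ^ 2 := mul_one _
  -- the weight `b^{5j}` cancels `Bj²`
  have hw : b ^ ((5 : ℝ) * (j : ℝ)) * Bj ^ 2 = 1 := by
    rw [hBj, sq, ← Real.rpow_add hb, ← Real.rpow_add hb]
    have : (5 : ℝ) * (j : ℝ) + (-((5 : ℝ) * (j : ℝ) / 2) + -((5 : ℝ) * (j : ℝ) / 2)) = 0 := by ring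
    rw [this, Real.rpow_zero]
  have hw0 : 0 ≤ b ^ ((5 : ℝ) * (j : ℝ)) := (Real.rpow_pos_of_pos hb _).le
  calc b ^ ((5 : ℝ) * (j : ℝ)) * Z (j : ℤ) t ^ 2 ≤ b ^ ((5 : ℝ) * (j : ℝ)) * (|x₀| * Bj) ^ 2 :=
        mul_le_mul_of_nonneg_left h1 hw0
    _ = (b ^ ((5 : ℝ) * (j : ℝ)) * Bj ^ 2) * |x₀| ^ 2 := by ring
    _ = x₀ ^ 2 := by rw [hw, one_mul, sq_abs]

/-- **Every barrier of the stubs holds before one turnover time.** Under the same hypotheses with `b ≥ 1`: for every exponent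
`θ ≤ 5/2`, every constant `D ≥ 1`, every `t ∈ [0,s]` with `c₀ b^{5/2} |x₀| t ≤ 1` and every shell `j`:
`(b^θ)^{2j} Z_j(t)² ≤ D x₀²` — in particular the `(θ, D)` barriers with `1/2 < θ ≤ 1` of the registered stubs can first fail only
after the datum shell has turned over once, whatever `ν`. [this file] -/
theorem kpChain_barrier_before_turnover {b c₀ ν s x₀ : ℝ} (hb : 1 ≤ b) (hc₀ : 0 ≤ c₀) (hν : 0 ≤ ν)
    {Z : ℤ → ℝ → ℝ}
    (hdat : ∀ k : ℤ, Z k 0 = if k = 0 then x₀ else 0)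
    (hvan : ∀ t, Z (-1) t = 0)
    (hcont : ∀ k : ℕ, ContinuousOn (Z k) (Icc 0 s))
    (hode : ∀ k : ℕ, ∀ t ∈ Icc 0 s, HasDerivWithinAt (Z k)
      (c₀ * (b ^ ((5 : ℝ) * ((k : ℝ) - 1) / 2) * Z ((k : ℤ) - 1) t ^ 2 -
          b ^ ((5 : ℝ) * (k : ℝ) / 2) * (Z k t * Z ((k : ℤ) + 1) t)) -
        ν * b ^ ((2 : ℝ) * (k : ℝ)) * Z k t) (Icc 0 s) t)
    (hnn : ∀ t ∈ Icc 0 s, ∀ k : ℕ, 1 ≤ k → 0 ≤ Z k t)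
    {θ D : ℝ} (hθ : θ ≤ 5 / 2) (hD : 1 ≤ D)
    {t : ℝ} (ht : t ∈ Icc 0 s) (hturn : c₀ * b ^ ((5 : ℝ) / 2) * |x₀| * t ≤ 1) (j : ℕ) :
    (b ^ θ) ^ (2 * j) * Z (j : ℤ) t ^ 2 ≤ D * x₀ ^ 2 := by
  have hb0 : 0 < b := by linarith
  have hsuper := kpChain_superBarrier_before_turnover hb0 hc₀ hν hdat hvan hcont hode hnn ht hturn j
  -- `(b^θ)^{2j} ≤ b^{5j}` for `b ≥ 1`, `θ ≤ 5/2`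
  have hw : (b ^ θ) ^ (2 * j) ≤ b ^ ((5 : ℝ) * (j : ℝ)) := by
    rw [← Real.rpow_mul_natCast hb0.le]
    apply Real.rpow_le_rpow_of_exponent_le hb
    push_cast
    have hj : (0 : ℝ) ≤ (j : ℝ) := Nat.cast_nonneg j
    nlinarith
  have hz : 0 ≤ Z (j : ℤ) t ^ 2 := sq_nonneg _
  have hx : 0 ≤ x₀ ^ 2 := sq_nonneg _
  calc (b ^ θ) ^ (2 * j) * Z (j : ℤ) t ^ 2 ≤ b ^ ((5 : ℝ) * (j : ℝ)) * Z (j : ℤ) t ^ 2 :=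
        mul_le_mul_of_nonneg_right hw hz
    _ ≤ x₀ ^ 2 := hsuper
    _ = 1 * x₀ ^ 2 := (one_mul _).symm
    _ ≤ D * x₀ ^ 2 := mul_le_mul_of_nonneg_right hD hx

end Summit.NavierStokesRegularity.NavierStokesRegularity.Theorems.KPChainLightCone

end
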